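import Summits.CriticalPhenomena.PercolationContinuityZ3.Theorems.PercNearOneGluingNoHeavyLowerTailSahiOneStep
import HarnessLib

/-!
# One-step scheme: the CONE INTERFACE — hypotheses on up-set indicators suffice; closed forms of `m′`, `n` on indicators

Support file (prover prim-ineq-prove-3 gen 14; `--supports stmt-CriticalPhenomena-4575`; memo `run/shared/lean/prim/prim-ineq-prove-3/FINDING-G14-ONESTEP-THRESHOLD.md` §2).
No definitions, no named facts, no sorries.
* `osMp_ind_ind`: `m′(1_A,1_B) = (1 + P H)·P(H∩A∩B) − P(H)·P(A∩B) − P(H∩A)·P(H∩B)`  (≥ 0 ⟺ `Cov(1_{H∩A},1_{H∩B}) ≥ P(H)·P(A∩B∖H)`);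
* `osN_ind_ind`:  `n(1_A,1_B) = P(HA)P(HB) + (1−P H)P(HAB) + P(H)P(A)P(B) − P(HA)P(B) − P(HB)P(A)`  (≥ 0 ⟺ `Cov(A,B) ≥ P(Hᶜ)·Cov(A,B ∣ Hᶜ)`);
* `cone_of_upperSet_core` — layer cake for increasing nonnegative functions determined by `F` (adapted from `SahiTransportCert.cone_of_upperSet`);
* `oneStepPos_of_ind` — `m′, n ≥ 0` on pairs of indicators of up-sets determined by `F` ⟹ `OneStepPos p H F` (bilinearity + cone lemma);
* `sahiE3_nonneg_of_ind` — **the one-step theorem with event-form hypotheses**: two inequalities for up-sets of the block ⟹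
  `0 ≤ E₃(H, A, B)` for ALL increasing `A, B ⊆ 2^ι`.
-/

noncomputable section

namespace Summit.CriticalPhenomena.PercolationContinuityZ3.Theorems

namespace SahiOneStep

open Literature.Combinatorics.Sahi2008
open Literature.Probability.Percolation (DeterminedBy determinedBy_iff)
open Literature.Probability.Percolation.DecisionTree (ind ind_of_mem ind_of_not_mem ind_nonneg)
open Literature.Probability.Percolation.BHK2006 (weight weight_nonneg blockFubini harris)
open Literature.Probability.LatticeModels (prodBernoulli sahiE3 sahiE3_def)
open SahiCdd (sec ex_congr' ex_lin2 ex_lin4 ex_split ex_mul_split sec_insert_of_not_mem sec_insert_insert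
  sec_comp_insert sec_comp_sdiff sec_apply_insert sec_apply_sdiff monotone_sec dep_insert dep_sdiff ex_mul_le_ex_mul)

variable {ι : Type*} [Fintype ι] [DecidableEq ι]

/-! ## The cone interface: hypotheses on UP-SET INDICATORS suffice -/

omit [DecidableEq ι] in
/-- `ex` of `(f + a•f')·g·h`-type products is linear: helper for the bilinearity lemmas. [folklore] -/
private theorem ex_ind_add_smul_mul (p : ι → unitInterval) (H : Set (Set ι)) (f f' g : Set ι → ℝ) (a : ℝ) :
    ex (bernoulliWeight p) (ind H * (f + a • f') * g) =
      ex (bernoulliWeight p) (ind H * f * g) + a * ex (bernoulliWeight p) (ind H * f' * g) := by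
  rw [ex_congr' (fun ω => show (ind H * (f + a • f') * g) ω = 1 * (ind H * f * g) ω + a * (ind H * f' * g) ω from by
    simp only [Pi.mul_apply, Pi.add_apply, Pi.smul_apply, smul_eq_mul]; ring), ex_lin2]
  ring

omit [DecidableEq ι] in
/-- Linearity of `E[1_H (f + a f')]`. [folklore] -/
private theorem ex_ind_add_smul (p : ι → unitInterval) (H : Set (Set ι)) (f f' : Set ι → ℝ) (a : ℝ) :
    ex (bernoulliWeight p) (ind H * (f + a • f')) =
      ex (bernoulliWeight p) (ind H * f) + a * ex (bernoulliWeight p) (ind H * f') := by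
  rw [ex_congr' (fun ω => show (ind H * (f + a • f')) ω = 1 * (ind H * f) ω + a * (ind H * f') ω from by
    simp only [Pi.mul_apply, Pi.add_apply, Pi.smul_apply, smul_eq_mul]; ring), ex_lin2]
  ring

omit [DecidableEq ι] in
/-- Linearity of `E[(f + a f') g]`. [folklore] -/
private theorem ex_add_smul_mul (p : ι → unitInterval) (f f' g : Set ι → ℝ) (a : ℝ) :
    ex (bernoulliWeight p) ((f + a • f') * g) =
      ex (bernoulliWeight p) (f * g) + a * ex (bernoulliWeight p) (f' * g) := by
  rw [ex_congr' (fun ω => show ((f + a • f') * g) ω = 1 * (f * g) ω + a * (f' * g) ω from by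
    simp only [Pi.mul_apply, Pi.add_apply, Pi.smul_apply, smul_eq_mul]; ring), ex_lin2]
  ring

omit [DecidableEq ι] in
/-- Linearity of `E[f + a f']`. [folklore] -/
private theorem ex_add_smul (p : ι → unitInterval) (f f' : Set ι → ℝ) (a : ℝ) :
    ex (bernoulliWeight p) (f + a • f') = ex (bernoulliWeight p) f + a * ex (bernoulliWeight p) f' := by
  rw [ex_congr' (fun ω => show (f + a • f') ω = 1 * f ω + a * f' ω from by
    simp only [Pi.add_apply, Pi.smul_apply, smul_eq_mul]; ring), ex_lin2]
  ring

omit [DecidableEq ι] in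
/-- `m′` is linear in its first argument. [this work] -/
theorem osMp_add_smul_left (p : ι → unitInterval) (H : Set (Set ι)) (f f' g : Set ι → ℝ) (a : ℝ) :
    osMp p H (f + a • f') g = osMp p H f g + a * osMp p H f' g := by
  unfold osMp osCert
  simp only [osD_eq]
  have m1 : ∀ u v : Set ι → ℝ, ind H * (u * v) = ind H * u * v := fun u v => by rw [mul_assoc]
  simp only [m1]
  rw [ex_ind_add_smul_mul, ex_ind_add_smul, ex_add_smul_mul]
  ring

omit [DecidableEq ι] in
/-- `n` is linear in its first argument. [this work] -/
theorem osN_add_smul_left (p : ι → unitInterval) (H : Set (Set ι)) (f f' g : Set ι → ℝ) (a : ℝ) :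
    osN p H (f + a • f') g = osN p H f g + a * osN p H f' g := by
  unfold osN osCert
  rw [ex_ind_add_smul_mul, ex_ind_add_smul, ex_add_smul]
  ring

omit [DecidableEq ι] in
/-- `m′` is symmetric. [this work] -/
theorem osMp_comm (p : ι → unitInterval) (H : Set (Set ι)) (f g : Set ι → ℝ) : osMp p H f g = osMp p H g f := by
  unfold osMp osCert
  have e1 : f * g = g * f := mul_comm f g
  have e2 : ind H * f * g = ind H * g * f := by rw [mul_assoc, mul_assoc, mul_comm f g]
  rw [e1, e2]; ring

omit [DecidableEq ι] in
/-- `n` is symmetric. [this work] -/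
theorem osN_comm (p : ι → unitInterval) (H : Set (Set ι)) (f g : Set ι → ℝ) : osN p H f g = osN p H g f := by
  unfold osN osCert
  have e2 : ind H * f * g = ind H * g * f := by rw [mul_assoc, mul_assoc, mul_comm f g]
  rw [e2]; ring

omit [DecidableEq ι] in
/-- `E[1_X · 1_Y] = P(X ∩ Y)` under the product weight. [folklore] -/
private theorem ex_ind_mul_ind (p : ι → unitInterval) (X Y : Set (Set ι)) :
    ex (bernoulliWeight p) (ind X * ind Y) = (prodBernoulli p).real (X ∩ Y) := by
  rw [← ex_bernoulliWeight_ind]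
  exact ex_congr' fun ω => by
    rw [Pi.mul_apply, Literature.Probability.Percolation.BHK2006.ind_inter]

omit [DecidableEq ι] in
/-- `E[1_X · 1_Y · 1_Z] = P(X ∩ Y ∩ Z)` under the product weight. [folklore] -/
private theorem ex_ind_mul_ind_mul_ind (p : ι → unitInterval) (X Y Z : Set (Set ι)) :
    ex (bernoulliWeight p) (ind X * ind Y * ind Z) = (prodBernoulli p).real (X ∩ Y ∩ Z) := by
  rw [← ex_bernoulliWeight_ind]
  exact ex_congr' fun ω => by
    rw [Pi.mul_apply, Pi.mul_apply, Literature.Probability.Percolation.BHK2006.ind_inter,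
      Literature.Probability.Percolation.BHK2006.ind_inter]

omit [DecidableEq ι] in
/-- **`m′` on indicators** (canonical certificate): `m′(1_A,1_B) = (1 + P H)·P(H∩A∩B) − P(H)·P(A∩B) − P(H∩A)·P(H∩B)`; its
nonnegativity is the quantitative Harris inequality `Cov(1_{H∩A},1_{H∩B}) ≥ P(H)·P(A∩B∖H)` of the memo. [this work] -/
theorem osMp_ind_ind (p : ι → unitInterval) (H A B : Set (Set ι)) :
    osMp p H (ind A) (ind B) =
      (1 + (prodBernoulli p).real H) * (prodBernoulli p).real (H ∩ A ∩ B)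
        - (prodBernoulli p).real H * (prodBernoulli p).real (A ∩ B)
        - (prodBernoulli p).real (H ∩ A) * (prodBernoulli p).real (H ∩ B) := by
  unfold osMp osCert
  rw [osD_eq]
  have m1 : ind H * (ind A * ind B) = ind H * ind A * ind B := by rw [mul_assoc]
  rw [m1, ex_ind_mul_ind_mul_ind, ex_ind_mul_ind, ex_ind_mul_ind, ex_ind_mul_ind, ex_bernoulliWeight_ind]
  ring

omit [DecidableEq ι] in
/-- **`n` on indicators** (canonical certificate): `n(1_A,1_B) = P(H∩A)P(H∩B) + (1 − P H)P(H∩A∩B) + P(H)P(A)P(B) − P(H∩A)P(B) − P(H∩B)P(A)`;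
its nonnegativity is `Cov(A,B) ≥ P(Hᶜ)·Cov(A,B ∣ Hᶜ)` of the memo. [this work] -/
theorem osN_ind_ind (p : ι → unitInterval) (H A B : Set (Set ι)) :
    osN p H (ind A) (ind B) =
      (prodBernoulli p).real (H ∩ A) * (prodBernoulli p).real (H ∩ B)
        + (1 - (prodBernoulli p).real H) * (prodBernoulli p).real (H ∩ A ∩ B)
        + (prodBernoulli p).real H * (prodBernoulli p).real A * (prodBernoulli p).real B
        - (prodBernoulli p).real (H ∩ A) * (prodBernoulli p).real B
        - (prodBernoulli p).real (H ∩ B) * (prodBernoulli p).real A := by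
  unfold osN osCert
  rw [ex_ind_mul_ind_mul_ind, ex_ind_mul_ind, ex_ind_mul_ind, ex_bernoulliWeight_ind, ex_bernoulliWeight_ind,
    ex_bernoulliWeight_ind]
  ring

omit [DecidableEq ι] in
/-- **Cone lemma for core functions** (layer cake): a functional on `Set ι → ℝ` which is linear and nonnegative on indicators of up-sets
determined by `F` is nonnegative on every increasing nonnegative function determined by `F` (adapted from
`SahiTransportCert.cone_of_upperSet`). [this work] -/
theorem cone_of_upperSet_core (F : Finset ι) (Φ : (Set ι → ℝ) → ℝ) (hlin : ∀ f f' a, Φ (f + a • f') = Φ f + a * Φ f')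
    (hup : ∀ A : Set (Set ι), IsUpperSet A → DeterminedBy A (F : Set ι) → 0 ≤ Φ (ind A)) :
    ∀ f : Set ι → ℝ, Monotone f → (∀ ω, 0 ≤ f ω) → (∀ ω, f ω = f (ω ∩ (F : Set ι))) → 0 ≤ Φ f := by
  classical
  have hzero : Φ 0 = 0 := by
    have h := hlin 0 0 1
    simp only [smul_zero, add_zero, one_mul] at h
    linarith
  suffices key : ∀ n : ℕ, ∀ f : Set ι → ℝ, (Finset.univ.filter fun ω => f ω ≠ 0).card ≤ n →
      Monotone f → (∀ ω, 0 ≤ f ω) → (∀ ω, f ω = f (ω ∩ (F : Set ι))) → 0 ≤ Φ f from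
    fun f hf hf0 hfF => key _ f le_rfl hf hf0 hfF
  intro n
  induction n with
  | zero =>
    intro f hcard _ _ _
    have hf : f = 0 := by
      funext ω
      have : ω ∉ Finset.univ.filter fun ω => f ω ≠ 0 := by
        rw [Nat.le_zero, Finset.card_eq_zero] at hcard; rw [hcard]; exact Finset.notMem_empty ω
      simpa [Finset.mem_filter] using this
    rw [hf, hzero]
  | succ n ih =>
    intro f hcard hmono hf0 hfF
    by_cases hempty : (Finset.univ.filter fun ω => f ω ≠ 0) = ∅
    · exact ih f (by rw [hempty, Finset.card_empty]; exact Nat.zero_le _) hmono hf0 hfF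
    obtain ⟨ω₀, hω₀, hmin⟩ :=
      Finset.exists_min_image (Finset.univ.filter fun ω => f ω ≠ 0) f (Finset.nonempty_iff_ne_empty.2 hempty)
    have hω₀ne : f ω₀ ≠ 0 := (Finset.mem_filter.1 hω₀).2
    have hm : 0 < f ω₀ := lt_of_le_of_ne (hf0 ω₀) (Ne.symm hω₀ne)
    set A : Set (Set ι) := {ω | f ω ≠ 0} with hA
    have hAup : IsUpperSet A := by
      intro ω η hle hω
      have : 0 < f ω := lt_of_le_of_ne (hf0 ω) (Ne.symm hω)
      exact ne_of_gt (lt_of_lt_of_le this (hmono hle))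
    have hAF : DeterminedBy A (F : Set ι) := by
      rw [determinedBy_iff]
      intro ω η h
      simp only [hA, Set.mem_setOf_eq]
      rw [hfF ω, hfF η, h]
    set f' : Set ι → ℝ := fun ω => f ω - f ω₀ * ind A ω with hf'
    have hf'val : ∀ ω, f' ω = if f ω = 0 then 0 else f ω - f ω₀ := by
      intro ω
      by_cases h : f ω = 0
      · rw [if_pos h, hf']; simp only; rw [h, ind_of_not_mem (show ω ∉ A from fun h' => h' h)]; ring
      · rw [if_neg h, hf']; simp only; rw [ind_of_mem (show ω ∈ A from h)]; ring
    have hf'0 : ∀ ω, 0 ≤ f' ω := by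
      intro ω; rw [hf'val]
      by_cases h : f ω = 0
      · rw [if_pos h]
      · rw [if_neg h]; exact sub_nonneg.2 (hmin ω (Finset.mem_filter.2 ⟨Finset.mem_univ _, h⟩))
    have hf'mono : Monotone f' := by
      intro ω η hle
      rw [hf'val, hf'val]
      by_cases hω : f ω = 0
      · rw [if_pos hω]
        by_cases hη : f η = 0
        · rw [if_pos hη]
        · rw [if_neg hη]; exact sub_nonneg.2 (hmin η (Finset.mem_filter.2 ⟨Finset.mem_univ _, hη⟩))
      · have hη : f η ≠ 0 := hAup hle hω
        rw [if_neg hω, if_neg hη]; exact sub_le_sub_right (hmono hle) _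
    have hf'F : ∀ ω, f' ω = f' (ω ∩ (F : Set ι)) := by
      intro ω
      rw [hf'val, hf'val, ← hfF ω]
    have hcard' : (Finset.univ.filter fun ω => f' ω ≠ 0).card ≤ n := by
      have hsub : (Finset.univ.filter fun ω => f' ω ≠ 0) ⊆ (Finset.univ.filter fun ω => f ω ≠ 0).erase ω₀ := by
        intro ω hω
        have hω' := (Finset.mem_filter.1 hω).2
        rw [Finset.mem_erase, Finset.mem_filter]
        refine ⟨?_, Finset.mem_univ _, ?_⟩
        · rintro rfl; rw [hf'val, if_neg hω₀ne, sub_self] at hω'; exact hω' rfl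
        · intro h; rw [hf'val, if_pos h] at hω'; exact hω' rfl
      have := Finset.card_le_card hsub
      rw [Finset.card_erase_of_mem hω₀] at this
      omega
    have hdecomp : f = f' + f ω₀ • ind A := by
      funext ω; simp only [hf', Pi.add_apply, Pi.smul_apply, smul_eq_mul]; ring
    rw [hdecomp, hlin]
    exact add_nonneg (ih f' hcard' hf'mono hf'0 hf'F) (mul_nonneg hm.le (hup A hAup hAF))

omit [DecidableEq ι] in
/-- **The cone interface.**  If `m′(1_A, 1_B) ≥ 0` and `n(1_A, 1_B) ≥ 0` for all up-sets `A, B` determined by `F`, then `OneStepPos p H F`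
(bilinearity of `m′`, `n` and the layer-cake cone lemma, used once in each argument). [this work] -/
theorem oneStepPos_of_ind (p : ι → unitInterval) (H : Set (Set ι)) (F : Finset ι)
    (h3 : ∀ A B : Set (Set ι), IsUpperSet A → IsUpperSet B → DeterminedBy A (F : Set ι) → DeterminedBy B (F : Set ι) →
      0 ≤ osMp p H (ind A) (ind B))
    (h2 : ∀ A B : Set (Set ι), IsUpperSet A → IsUpperSet B → DeterminedBy A (F : Set ι) → DeterminedBy B (F : Set ι) →
      0 ≤ osN p H (ind A) (ind B)) :
    OneStepPos p H F := by
  intro φ ψ hφ hψ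
  obtain ⟨hφm, hφ01, hφF⟩ := hφ
  obtain ⟨hψm, hψ01, hψF⟩ := hψ
  constructor
  · -- m′: first extend in the second argument against indicators, then in the first
    have step1 : ∀ A : Set (Set ι), IsUpperSet A → DeterminedBy A (F : Set ι) → 0 ≤ osMp p H ψ (ind A) := by
      intro A hA hAF
      refine cone_of_upperSet_core F (fun g => osMp p H g (ind A)) (fun f₁ f₂ a => osMp_add_smul_left p H f₁ f₂ _ a)
        (fun B hB hBF => ?_) ψ hψm (fun ω => (hψ01 ω).1) hψF
      rw [osMp_comm]; exact h3 A B hA hB hAF hBF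
    refine cone_of_upperSet_core F (fun f => osMp p H f ψ) (fun f₁ f₂ a => osMp_add_smul_left p H f₁ f₂ _ a)
      (fun A hA hAF => ?_) φ hφm (fun ω => (hφ01 ω).1) hφF
    rw [osMp_comm]; exact step1 A hA hAF
  · have step1 : ∀ A : Set (Set ι), IsUpperSet A → DeterminedBy A (F : Set ι) → 0 ≤ osN p H ψ (ind A) := by
      intro A hA hAF
      refine cone_of_upperSet_core F (fun g => osN p H g (ind A)) (fun f₁ f₂ a => osN_add_smul_left p H f₁ f₂ _ a)
        (fun B hB hBF => ?_) ψ hψm (fun ω => (hψ01 ω).1) hψF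
      rw [osN_comm]; exact h2 A B hA hB hAF hBF
    refine cone_of_upperSet_core F (fun f => osN p H f ψ) (fun f₁ f₂ a => osN_add_smul_left p H f₁ f₂ _ a)
      (fun A hA hAF => ?_) φ hφm (fun ω => (hφ01 ω).1) hφF
    rw [osN_comm]; exact step1 A hA hAF

omit [DecidableEq ι] in
/-- **THEOREM (one-step scheme, event form of the hypotheses).**  If `H` is determined by `F` and for all up-sets `A, B` determined
by `F` both `m′(1_A,1_B) ≥ 0` and `n(1_A,1_B) ≥ 0` — for the canonical certificate: `(1+π(H))π(H∩A∩B) ≥ π(H∩A)π(H∩B) + π(H)π(A∩B)`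
and `π(H∩A)π(H∩B) + π(Hᶜ)π(H∩A∩B) + π(H)π(A)π(B) ≥ π(H∩A)π(B) + π(H∩B)π(A)` — then `0 ≤ E₃(H, A, B)` for ALL increasing `A, B ⊆ 2^ι`.
[this work] -/
theorem sahiE3_nonneg_of_ind (p : ι → unitInterval) {H : Set (Set ι)} {F : Finset ι} (hH : DeterminedBy H (F : Set ι))
    (h3 : ∀ A B : Set (Set ι), IsUpperSet A → IsUpperSet B → DeterminedBy A (F : Set ι) → DeterminedBy B (F : Set ι) →
      0 ≤ osMp p H (ind A) (ind B))
    (h2 : ∀ A B : Set (Set ι), IsUpperSet A → IsUpperSet B → DeterminedBy A (F : Set ι) → DeterminedBy B (F : Set ι) →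
      0 ≤ osN p H (ind A) (ind B))
    {A B : Set (Set ι)} (hA : IsUpperSet A) (hB : IsUpperSet B) :
    0 ≤ sahiE3 (prodBernoulli p) H A B :=
  sahiE3_nonneg_of_oneStepPos p hH (oneStepPos_of_ind p H F h3 h2) hA hB

end SahiOneStep

end Summit.CriticalPhenomena.PercolationContinuityZ3.Theorems
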